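import Mathlib
import Literature.AlgebraicGeometry.Modules.SheafHomLeft
import Literature.AlgebraicGeometry.Modules.SheafHomFunctor
import Literature.AlgebraicGeometry.Modules.LocalFrames
import Literature.AlgebraicGeometry.Morphisms.CechModuleBiproduct
import Literature.AlgebraicGeometry.Morphisms.FormalModuleAffine
import HarnessLib

/-!
# Crux `NoZenoR` (stmt-ResolutionOfSingularities-19943), line `sandwich-cluster`, G-layer G2 (vii), part 2:
# `Ȟ¹(𝒰, (𝒪_X^n)^∨) = 0` when `Ȟ¹(𝒰, 𝒪_X) = 0`

OURS (cell res-hironaka, chain W4.4; G2 «full-sheaf package» clause (vii); seat res-D-pv-024). Čech /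
internal-Hom plumbing over the tree's `Modules/SheafHom*`, `Morphisms/CechModule*`; nothing of
[claim: Hironaka2017] is used; AI-written, weaker than expert review.

* `sheafHomMapLeft_sum` — `𝓗om(∑ φⱼ, N) = ∑ 𝓗om(φⱼ, N)`;
* `subsingleton_cechMH1_sheafHom_biproduct_left` — **`Ȟ¹(𝒰, 𝓗om(⨁ⱼ Fⱼ, N)) = 0` if all
  `Ȟ¹(𝒰, 𝓗om(Fⱼ, N)) = 0`** (first variable; companion of `SheafHomLeft`'s binary `biprod` lemma and of
  the second-variable lemma of `…NoZenoSheafHomBiproduct`): `x = ∑ⱼ Ȟ¹(𝓗om(πⱼ,N)) (Ȟ¹(𝓗om(ιⱼ,N)) x)`;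
* `isIso_sheafHomUnit_unitModule` — **`𝒪_X ≅ 𝓔nd(𝒪_X)`**: the unit `a ↦ a · 𝟙` is bijective on
  sections over every open (an endomorphism `χ` of `𝒪_U` is multiplication by `χ(1)`);
* `subsingleton_cechMH1_dual_freeMod` — **`Ȟ¹(𝒰, (𝒪_X^n)^∨) = 0` from `Ȟ¹(𝒰, 𝒪_X) = 0`**
  (`𝒪_X^n ≅ ⨁ 𝒪_X`, `sheafHomMapLeftIso`, the two lemmas above, `CechMH1_unit`).

References: The Stacks Project, Tags 01CM, 01ED [`StacksProject`].
-/

-- single-problem summit: the doubled namespace component `ResolutionOfSingularities` is forced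
set_option linter.dupNamespace false

noncomputable section

universe u v w

open CategoryTheory CategoryTheory.Limits AlgebraicGeometry TopologicalSpace Opposite
open Literature.AlgebraicGeometry.Morphisms Literature.AlgebraicGeometry.Modules

namespace Summit.ResolutionOfSingularities.ResolutionOfSingularities.Theorems.NoZeno.SandwichCluster.FullSheaf

variable {X : Scheme.{u}}

/-! ## `𝓗om(–, N)` on finite sums and finite direct sums -/

/-- `𝓗om(∑_{j ∈ s} φⱼ, N) = ∑_{j ∈ s} 𝓗om(φⱼ, N)`. [this work] -/
theorem sheafHomMapLeft_sum {E₁ E₂ : X.Modules} (N : X.Modules) {J : Type*} (s : Finset J)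
    (φ : J → (E₁ ⟶ E₂)) :
    sheafHomMapLeft (∑ j ∈ s, φ j) N = ∑ j ∈ s, sheafHomMapLeft (φ j) N := by
  classical
  induction s using Finset.induction_on with
  | empty => rw [Finset.sum_empty, Finset.sum_empty, sheafHomMapLeft_zero]
  | insert j s hj ih => rw [Finset.sum_insert hj, Finset.sum_insert hj, sheafHomMapLeft_add, ih]

variable {A : Type u} [CommRing A] (f : X ⟶ Spec (.of A)) {ι : Type v} (U : ι → X.Opens)

/-- **`Ȟ¹(𝒰, 𝓗om(⨁ⱼ Fⱼ, N)) = 0` if `Ȟ¹(𝒰, 𝓗om(Fⱼ, N)) = 0` for all `j`** (`J` finite): every class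
`x` equals `Ȟ¹(𝓗om(∑ πⱼ ιⱼ, N)) x = ∑ⱼ Ȟ¹(𝓗om(πⱼ, N)) (Ȟ¹(𝓗om(ιⱼ, N)) x)` and the inner classes live in
`Ȟ¹(𝒰, 𝓗om(Fⱼ, N)) = 0`. [this work] -/
theorem subsingleton_cechMH1_sheafHom_biproduct_left {J : Type w} [Finite J] (F : J → X.Modules)
    [HasBiproduct F] (N : X.Modules)
    (hF : ∀ j, Subsingleton (CechMH1 f (sheafHom (F j) N) U)) :
    Subsingleton (CechMH1 f (sheafHom (⨁ F) N) U) := by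
  classical
  cases nonempty_fintype J
  refine subsingleton_of_forall_eq 0 fun x => ?_
  have htot : ∑ j, biproduct.π F j ≫ biproduct.ι F j = 𝟙 (⨁ F) :=
    Limits.IsBilimit.total (biproduct.isBilimit F)
  have hzero : ∀ j, cechMapH1 f (sheafHomMapLeft (biproduct.ι F j) N) U x = 0 :=
    fun j => Subsingleton.elim _ _
  rw [← cechMapH1_id_apply f U x, ← sheafHomMapLeft_id, ← htot, sheafHomMapLeft_sum,
    cechMapH1_sum_apply]
  refine Finset.sum_eq_zero fun j _ => ?_
  rw [sheafHomMapLeft_comp, cechMapH1_comp, hzero j, map_zero]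

/-! ## `𝒪_X ≅ 𝓔nd(𝒪_X)` -/

/-- **The unit `𝒪_X → 𝓔nd(𝒪_X) = 𝓗om(𝒪_X, 𝒪_X)`, `a ↦ a · 𝟙`, is an isomorphism**: on sections over
every open `U` it is injective (evaluate at `1`) and surjective (an `𝒪_U`-linear endomorphism `χ` of
`𝒪_U` is multiplication by `χ_U(1)`: `χ_W(s) = χ_W(s · 1|_W) = s · χ_U(1)|_W`). [this work] -/
theorem isIso_sheafHomUnit_unitModule : IsIso (sheafHomUnit (unitModule X)) := by
  rw [Scheme.Modules.Hom.isIso_iff_isIso_app]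
  intro V
  rw [ConcreteCategory.isIso_iff_bijective]
  constructor
  · intro a b hab
    have h := congrArg (fun χ : (unitModule X).over V ⟶ (unitModule X).over V =>
      appLE χ (𝟙 V) (1 : Γ(X, V))) hab
    simp only [sheafHomUnit_app_apply, appLE_overScalar, op_id] at h
    have h1 : X.presheaf.map (𝟙 (op V)) a • (1 : Γ(X, V)) = X.presheaf.map (𝟙 (op V)) b • 1 := h
    rwa [X.presheaf.map_id, smul_eq_mul, smul_eq_mul, mul_one, mul_one] at h1
  · intro χ₀
    obtain ⟨χ, rfl⟩ : ∃ χ : (unitModule X).over V ⟶ (unitModule X).over V,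
        (show Γ(sheafHom (unitModule X) (unitModule X), V) from χ) = χ₀ := ⟨χ₀, rfl⟩
    refine ⟨(show Γ(X, V) from appLE χ (𝟙 V) (1 : Γ(X, V))), ?_⟩
    rw [sheafHomUnit_app_apply]
    refine hom_ext_of_appLE fun W k s => ?_
    rw [appLE_overScalar]
    -- `χ_W(1|_W) = χ_V(1)|_W`
    have hk := appLE_map χ (𝟙 V) k (show Γ(unitModule X, V) from (1 : Γ(X, V)))
    rw [Category.comp_id] at hk
    have h1 : (unitModule X).presheaf.map k.op (show Γ(unitModule X, V) from (1 : Γ(X, V))) =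
        (show Γ(unitModule X, W) from (1 : Γ(X, W))) :=
      map_one (X.presheaf.map k.op).hom
    rw [h1] at hk
    -- `χ_W(s) = χ_W(s • 1) = s • χ_V(1)|_W`
    have hs : s = (show Γ(X, W) from s) • (show Γ(unitModule X, W) from (1 : Γ(X, W))) := by
      change s = (show Γ(X, W) from s) * (1 : Γ(X, W))
      rw [mul_one]
    conv_rhs => rw [hs, appLE_smul_right, hk]
    change X.presheaf.map k.op _ * (show Γ(X, W) from s) = (show Γ(X, W) from s) * X.presheaf.map k.op _
    exact mul_comm _ _

/-! ## `Ȟ¹(𝒰, (𝒪_X^n)^∨) = 0` -/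

/-- **`Ȟ¹(𝒰, (𝒪_X^n)^∨) = 0` as soon as `Ȟ¹(𝒰, 𝒪_X) = 0`**: `(𝒪_X^n)^∨ = 𝓗om(𝒪_X^n, 𝒪_X) ≅
𝓗om(⨁_k 𝒪_X, 𝒪_X)`, whose `Ȟ¹` vanishes with the `Ȟ¹(𝒰, 𝓗om(𝒪_X, 𝒪_X)) = Ȟ¹(𝒰, 𝒪_X) = 0`. [this work] -/
theorem subsingleton_cechMH1_dual_freeMod (n : ℕ) (hO : Subsingleton (CechH1 f U)) :
    Subsingleton (CechMH1 f (dual (freeMod X n)) U) := by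
  haveI : HasFiniteBiproducts X.Modules := HasFiniteBiproducts.of_hasFiniteProducts
  -- `Ȟ¹(𝓗om(𝒪_X, 𝒪_X)) = Ȟ¹(𝒪_X) = 0`
  have hunit : Subsingleton (CechMH1 f (sheafHom (unitModule X) (unitModule X)) U) := by
    haveI := isIso_sheafHomUnit_unitModule (X := X)
    have h0 : Subsingleton (CechMH1 f (unitModule X) U) := by
      change Subsingleton (CechMH1 f (SheafOfModules.unit X.ringCatSheaf) U)
      rwa [CechMH1_unit]
    exact subsingleton_cechMH1_of_iso f U (asIso (sheafHomUnit (unitModule X))).symm h0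
  -- `𝒪_X^n = ∐ 𝒪_X ≅ ⨁ 𝒪_X`, then the first-variable biproduct lemma
  let F : ULift.{u} (Fin n) → X.Modules := fun _ => unitModule X
  let e : ⨁ F ≅ freeMod X n := biproduct.isoCoproduct F
  have hsum : Subsingleton (CechMH1 f (sheafHom (⨁ F) (unitModule X)) U) :=
    subsingleton_cechMH1_sheafHom_biproduct_left f U F (unitModule X) fun _ => hunit
  exact subsingleton_cechMH1_of_iso f U (sheafHomMapLeftIso e (unitModule X)).symm hsum

end Summit.ResolutionOfSingularities.ResolutionOfSingularities.Theorems.NoZeno.SandwichCluster.FullSheaf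

end
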